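import Mathlib
import HarnessLib
import Literature.Analysis.FluidPDE.Tao2016AveragedNS.TaylorChainCertificate
import Summits.NavierStokesRegularity.NavierStokesRegularity.Theorems.TaylorModelRungThreeReadoutPackage
import Summits.NavierStokesRegularity.NavierStokesRegularity.Theorems.TaylorModelRungThreeReadoutJets
import Summits.NavierStokesRegularity.NavierStokesRegularity.Theorems.TaylorModelRungThreeReadoutFlow
import Summits.NavierStokesRegularity.NavierStokesRegularity.Theorems.TaylorModelRungThreeSoundnessDefs

/-!
# Line `taylor-model` on crux K1b-DR (stmt-NavierStokesRegularity-23954) — v3 (VECTOR STEP) semantic interface: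
# `StepBoxes`, `ChainVCore`, `IsFlowPackageV`   [by the (E) owner / VDefs pen-holder ns-tm-g4 g3; director dss_63/dss_65]

Definitions-only module (no theorems, no sorry).  Design (INBOX 2026-08-28, dss_56/58/63, CERT-CONTRACT-23954-v3,
VECTOR-LEMMAS-23954): the SEMANTIC record of a certificate stays `TaylorChain.CertData` (Literature, unchanged — every
v3 object is one of its fields; the scalar-majorant clauses live only in the predicate `CertData.Chain`, which v3 does
not assert); the componentwise (vector) step adds a companion record `StepBoxes` of per-sub-step a-priori BOXES and jet
ENCLOSURES, and the predicates

* `ChainVCore cd bx` — the part of the vector-step chain predicate the FLOW SIDE consumes (frame / jet-recursion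
  clauses of `CertData.Chain`'s a-block with exact frames; `Wv` recursion to order `pdegV`; `0 < h`, `Tn` update), and
  per sub-step, over the START HULLS `H^l_s = [hlo l, hhi l] ⊇ x_s + Cm_s·[−rPl l, rPl l]` (frame radii, three levels,
  NO propagated ω-ball — cert-1 ▶F3) and the a-priori box `B = [lo,hi]` / tube box: the rough-enclosure test for EVERY
  start of `H²` (first-order (E1) OR high-order (E2), checker's choice), the state-jet enclosure `J`, the κ-restart
  difference test (D1κ) with `Ball(κ) ⊆ BK` and `BK ≤ L1·κ·ω`, the unit-ω variational test (V1) on the tube box with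
  `Ball(1) ⊆ BV` and `BV ≤ L1·ω`, the vector variational-jet enclosure `JU` (order `pdegV+1`), and the signed one-step
  derivative enclosure `[Mlo, Mhi] ∋ Σ_{n≤pdegV} varJet z e_c n h^n ± JU/ω·h^(pdegV+1)` for `z ∈ H²` (= cert-1's `[M_s]`,
  PROPAGATE-V-SPEC §2 C).  The frame-absorbed RADIUS UPDATES, the derivative-enclosure transport `G_{s+1} = T_s·G_s`
  and the scalar output conversions form `ChainVRadii` in the successor's `FormatV` module, which also defines
  `ValidV := Static ∧ StageNumerics ∧ ChainVCore ∧ ChainVRadii ∧ ReadoutsV`;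
* (`ReadoutsV` is NOT in this file: its `bb`/transversality part transfers from `CertData.Readouts` (▶OPEN-R, dss_63), its
  `L1` clause is the BV row bound above, and its LANDING block is being replaced by the face-wise C¹-Lohner read-out of
  PROPAGATE-V-SPEC-cert1 §4 (▶F4, dss_65) — it lands in a separate defs file once that text is frozen;)
* `IsFlowPackageV cd bx φ` — the flow package the G-side consumes: (Fsel) `φ` IS the selector flow
  `liftFlow cd (flowSel (Qw cd))`; (F0) off-window zero and (F2) uniqueness VERBATIM from `IsFlowPackage`; per sub-step:
  (F1′) every start of the hull `H²` solves on `[0,h]` inside `B`; (F3′) κ-restarts from any tube trajectory solve over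
  the rest of the sub-step with difference in `BK`; (F4′) segment derivatives on the κ-tube bounded by `L1·dd·ω`; (F5′)
  Taylor model `|φ(z,u) − Σ_{n≤p} taylorJet cd.Qb z n u^n|_{ik} ≤ J i k·u^(p+1)` for every `z ∈ H²`; (F7′) in window
  coordinates, `yv ↦ flowSel (Qw cd) yv u` is Fréchet-differentiable WITHIN the hull box at every `zv ∈ H²` with columns
  in `ω_c⁻¹·[loV,hiV]` obeying the variational Taylor model (`JU`); (F8′) mean-value form: for `z, z' ∈ H²` there is a real
  matrix `A ∈ [Mlo,Mhi]` with `φ(z,h) − φ(z',h) = A·(z − z')` (window components) — the input of the Lohner transport.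
  All clauses are conclusions of the landed files `…SoundnessVector*` / `…ReadoutFlowV*` (p613013 … p619814).

`ChainEnclosure`, `Crossing`, `InPoly`, `tauSel`, `KBlock*`, `k1bDR_of_blocks` keep their texts (they read `cd` only).
MODEL-lattice rung TL-M3 only; nothing here is a statement about the Navier–Stokes equations, and nothing is asserted.
-/

noncomputable section

-- the sub-problem namespace repeats the summit name by design (D-0017)
set_option linter.dupNamespace false

namespace Summit.NavierStokesRegularity.NavierStokesRegularity.Theorems.TaylorModelV

open Set Literature.Analysis.FluidPDE.TaoCascade Literature.Analysis.FluidPDE.TaoCascade.TaylorChain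
open Summit.NavierStokesRegularity.NavierStokesRegularity.Theorems.TaylorModelReadout
open Summit.NavierStokesRegularity.NavierStokesRegularity.Theorems.TaylorModelMajorant

/-- Componentwise box on the window: `lo i k ≤ y i k ≤ hi i k` for `-Kb ≤ k ≤ Ka` (off-window components free).
[folklore] -/
def InBox (cd : CertData) (lo hi y : Fin 4 → ℤ → ℝ) : Prop :=
  ∀ i k, -cd.Kb ≤ k → k ≤ cd.Ka → lo i k ≤ y i k ∧ y i k ≤ hi i k

/-- **Companion record of the vector step** (all functions junk-valued beyond the indices used; cascade coordinates,
window components only are read): variational order `pdegV`; per NODE `(j,s)` three FRAME-RADIUS vectors `rPl l`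
(base trajectory / entry polytope / κ-restarts: node set `x + Cm·[−rPl l, rPl l]`); per SUB-STEP `(j,s)`: start hulls
`hlo l, hhi l` (boxes containing the node sets), the a-priori STATE box `lo hi` (all trajectories from `H²` on `[0,h]`),
the κ-RESTART difference box `loK hiK`, the VARIATION box `loV hiV` (unit-ω start directions, along tube trajectories),
the enclosures `J` (state jets of order `pdeg+1` over the tube box) and `JU` (vector variational jets of order `pdegV+1`
over tube box × variation box), and the signed one-step derivative enclosure `Mlo Mhi` (entries `row i' k'`, `column i k`).
[folklore] -/
structure StepBoxes where
  pdegV : ℕ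
  rPl : Fin 3 → ℕ → ℕ → (Fin 4 → ℤ → ℝ)
  (hlo hhi : Fin 3 → ℕ → ℕ → (Fin 4 → ℤ → ℝ))
  (lo hi loK hiK loV hiV J JU : ℕ → ℕ → (Fin 4 → ℤ → ℝ))
  (Mlo Mhi : ℕ → ℕ → (Fin 4 → ℤ → Fin 4 → ℤ → ℝ))

/-- Node-set states of node `s` of stage `j` at level `l`: `z = x + Cm ξ`, `|ξ| ≤ rPl l` (frame coordinates only).
[folklore] -/
def NodeStart (cd : CertData) (bx : StepBoxes) (j s : ℕ) (l : Fin 3) (z : Fin 4 → ℤ → ℝ) : Prop :=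
  ∃ ξ : Fin 4 → ℤ → ℝ, (∀ i k, -cd.Kb ≤ k → k ≤ cd.Ka → |ξ i k| ≤ bx.rPl l j s i k) ∧ z = cd.x j s + cd.Cm j s ξ

/-- The TUBE box of sub-step `(j,s)`: the a-priori state box widened by the κ-restart difference box (contains every
trajectory the read-outs look at during the sub-step). [folklore] -/
def InTube (cd : CertData) (bx : StepBoxes) (j s : ℕ) (y : Fin 4 → ℤ → ℝ) : Prop :=
  InBox cd (bx.lo j s + bx.loK j s) (bx.hi j s + bx.hiK j s) y

/-- The window basis state `e_(i,k)`. [folklore] -/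
def basisSt (i : Fin 4) (k : ℤ) : Fin 4 → ℤ → ℝ := fun i' k' => if i' = i ∧ k' = k then 1 else 0

/-- **(TM-V core) the flow-side part of the vector-step chain predicate** — see the module docstring. [folklore] -/
def ChainVCore (cd : CertData) (bx : StepBoxes) : Prop :=
  ∀ j, j ≤ cd.N₀ →
    1 ≤ cd.S j ∧ cd.Tn j 0 = 0 ∧
    -- node clauses (from `Chain`'s a-block): supports, exact frames, jet recursions (`Wv` to order `pdegV`), radii, hulls
    (∀ s', s' ≤ cd.S j →
      cd.Wsupp (cd.x j s') ∧ (∀ n, cd.Wsupp (cd.P j s' n)) ∧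
      IsLinearMap ℝ (cd.Cm j s') ∧ IsLinearMap ℝ (cd.Ci j s') ∧
      (∀ v, cd.Wsupp (cd.Cm j s' v) ∧ cd.Wsupp (cd.Ci j s' v) ∧
        (cd.Wsupp v → cd.Ci j s' (cd.Cm j s' v) = v ∧ cd.Cm j s' (cd.Ci j s' v) = v)) ∧
      cd.P j s' 0 = cd.x j s' ∧
      (∀ n, n < cd.pdeg → ∀ i k, ((n : ℝ) + 1) * cd.P j s' (n + 1) i k =
        ∑ m' ∈ Finset.range (n + 1), cd.Qb (cd.P j s' m') (cd.P j s' (n - m')) i k) ∧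
      (∀ v i k, cd.Wv j s' 0 v i k = if -cd.Kb ≤ k ∧ k ≤ cd.Ka then v i k else 0) ∧
      (∀ n, n < bx.pdegV → ∀ v i k, ((n : ℝ) + 1) * cd.Wv j s' (n + 1) v i k =
        ∑ m' ∈ Finset.range (n + 1),
          (cd.Qb (cd.P j s' m') (cd.Wv j s' (n - m') v) i k + cd.Qb (cd.Wv j s' (n - m') v) (cd.P j s' m') i k)) ∧
      (∀ n, bx.pdegV < n → ∀ v, cd.Wv j s' n v = 0) ∧
      (∀ l : Fin 3, ∀ i k, 0 ≤ bx.rPl l j s' i k) ∧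
      (∀ i k, bx.rPl 0 j s' i k ≤ bx.rPl 1 j s' i k ∧ bx.rPl 1 j s' i k ≤ bx.rPl 2 j s' i k) ∧
      (∀ l : Fin 3, ∀ z, NodeStart cd bx j s' l z → InBox cd (bx.hlo l j s') (bx.hhi l j s') z) ∧
      (∀ l : Fin 3, ∀ i k, bx.hlo 2 j s' i k ≤ bx.hlo l j s' i k ∧ bx.hhi l j s' i k ≤ bx.hhi 2 j s' i k)) ∧
    -- sub-step clauses
    (∀ s', s' < cd.S j →
      0 < cd.h j s' ∧ cd.Tn j (s' + 1) = cd.Tn j s' + cd.h j s' ∧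
      -- (E) every start of the outer hull passes a rough-enclosure test for the state box: first-order OR high-order
      ((∀ z, InBox cd (bx.hlo 2 j s') (bx.hhi 2 j s') z → InBox cd (bx.lo j s') (bx.hi j s') z ∧
          ∀ y, InBox cd (bx.lo j s') (bx.hi j s') y → ∀ u ∈ Icc 0 (cd.h j s'),
            InBox cd (bx.lo j s') (bx.hi j s') (z + u • cd.Qb y y)) ∨
        (∀ z, InBox cd (bx.hlo 2 j s') (bx.hhi 2 j s') z → ∀ u ∈ Icc 0 (cd.h j s'), ∀ i k, -cd.Kb ≤ k → k ≤ cd.Ka →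
          bx.lo j s' i k < (∑ n ∈ Finset.range (cd.pdeg + 1), taylorJet cd.Qb z n i k * u ^ n)
              - bx.J j s' i k * u ^ (cd.pdeg + 1) ∧
          (∑ n ∈ Finset.range (cd.pdeg + 1), taylorJet cd.Qb z n i k * u ^ n)
              + bx.J j s' i k * u ^ (cd.pdeg + 1) < bx.hi j s' i k)) ∧
      -- (J) state jets of order `pdeg+1` over the tube box
      (∀ y, InTube cd bx j s' y → ∀ i k, -cd.Kb ≤ k → k ≤ cd.Ka →
        |taylorJet cd.Qb y (cd.pdeg + 1) i k| ≤ bx.J j s' i k) ∧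
      -- (D1κ) κ-restart differences on the tube: box inclusions, test, Lipschitz row bound
      (∀ i k, -cd.Kb ≤ k → k ≤ cd.Ka → bx.loK j s' i k ≤ 0 ∧ 0 ≤ bx.hiK j s' i k ∧
        bx.loK j s' i k ≤ -(cd.κ j * cd.ω j k) ∧ cd.κ j * cd.ω j k ≤ bx.hiK j s' i k) ∧
      (∀ d₀ : Fin 4 → ℤ → ℝ, cd.InBall j d₀ (cd.κ j) →
        ∀ y d, InTube cd bx j s' y → InBox cd (bx.loK j s') (bx.hiK j s') d → ∀ u ∈ Icc 0 (cd.h j s'),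
          InBox cd (bx.loK j s') (bx.hiK j s') (d₀ + u • (cd.Qb y d + cd.Qb d y + cd.Qb d d))) ∧
      (∀ i k, -cd.Kb ≤ k → k ≤ cd.Ka → max |bx.loK j s' i k| |bx.hiK j s' i k| ≤ cd.L1 j s' * cd.κ j * cd.ω j k) ∧
      -- (V1) unit-ω variations along tube trajectories: box inclusion, test, row bound `L1`, variational jets `JU`
      (∀ i k, -cd.Kb ≤ k → k ≤ cd.Ka → bx.loV j s' i k ≤ -cd.ω j k ∧ cd.ω j k ≤ bx.hiV j s' i k) ∧
      (∀ v₀ : Fin 4 → ℤ → ℝ, cd.InBall j v₀ 1 →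
        ∀ y v, InBox cd (bx.lo j s' + bx.loK j s' + bx.loK j s') (bx.hi j s' + bx.hiK j s' + bx.hiK j s') y →
          InBox cd (bx.loV j s') (bx.hiV j s') v → ∀ u ∈ Icc 0 (cd.h j s'),
            InBox cd (bx.loV j s') (bx.hiV j s') (v₀ + u • (cd.Qb y v + cd.Qb v y))) ∧
      (∀ i k, -cd.Kb ≤ k → k ≤ cd.Ka → max |bx.loV j s' i k| |bx.hiV j s' i k| ≤ cd.L1 j s' * cd.ω j k) ∧
      (∀ y v, InBox cd (bx.lo j s' + bx.loK j s' + bx.loK j s') (bx.hi j s' + bx.hiK j s' + bx.hiK j s') y →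
        InBox cd (bx.loV j s') (bx.hiV j s') v → ∀ i k, -cd.Kb ≤ k → k ≤ cd.Ka →
          |varJet cd.Qb y v (bx.pdegV + 1) i k| ≤ bx.JU j s' i k) ∧
      -- (M) the signed one-step derivative enclosure over the outer hull (columns = window basis directions)
      (∀ z, InBox cd (bx.hlo 2 j s') (bx.hhi 2 j s') z → ∀ i k, -cd.Kb ≤ k → k ≤ cd.Ka → ∀ i' k', -cd.Kb ≤ k' → k' ≤ cd.Ka →
        bx.Mlo j s' i' k' i k ≤ (∑ n ∈ Finset.range (bx.pdegV + 1), varJet cd.Qb z (basisSt i k) n i' k' * cd.h j s' ^ n)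
            - bx.JU j s' i' k' * (cd.ω j k)⁻¹ * cd.h j s' ^ (bx.pdegV + 1) ∧
        (∑ n ∈ Finset.range (bx.pdegV + 1), varJet cd.Qb z (basisSt i k) n i' k' * cd.h j s' ^ n)
            + bx.JU j s' i' k' * (cd.ω j k)⁻¹ * cd.h j s' ^ (bx.pdegV + 1) ≤ bx.Mhi j s' i' k' i k))

/-- **The v3 flow package** (what the G-side consumes) — see the module docstring for the clause list. [folklore] -/
def IsFlowPackageV (cd : CertData) (bx : StepBoxes) (φ : Flow) : Prop :=
  (∀ j z i k t, φ j z i k t = liftFlow cd (fun x s => flowSel (Qw cd) x s) z i k t) ∧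
  ∀ j, j ≤ cd.N₀ →
    (∀ (z : (Fin 4 → ℤ → ℝ)) i k, ¬(-cd.Kb ≤ k ∧ k ≤ cd.Ka) → ∀ t, φ j z i k t = 0) ∧
    (∀ (z : (Fin 4 → ℤ → ℝ)) (T : ℝ) (ψ : Fin 4 → ℤ → ℝ → ℝ), 0 ≤ T →
      (∀ i k, -cd.Kb ≤ k → k ≤ cd.Ka → ψ i k 0 = z i k ∧ ∀ t' ∈ Icc 0 T,
        HasDerivWithinAt (ψ i k)
          (Literature.Analysis.FluidPDE.TaoCascade.quadTerm 1 cd.α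
            (fun j' n s' => if -cd.Kb ≤ n ∧ n ≤ cd.Ka then ψ j' n s' else 0) i k t') (Icc 0 T) t') →
      ∀ i k, -cd.Kb ≤ k → k ≤ cd.Ka → ∀ t' ∈ Icc 0 T, ψ i k t' = φ j z i k t') ∧
    (∀ s', s' < cd.S j →
      -- (F1′) every start of the outer hull: solves on `[0,h]`, stays in the state box
      (∀ z, InBox cd (bx.hlo 2 j s') (bx.hhi 2 j s') z → SolvesOn cd φ j z (cd.h j s') ∧
        ∀ u ∈ Icc 0 (cd.h j s'), InBox cd (bx.lo j s') (bx.hi j s') (stAt φ j z u)) ∧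
      -- (F3′) κ-restarts from the tube: `w` any state whose trajectory solves on `[0,h]` inside the state box
      (∀ (w : Fin 4 → ℤ → ℝ) (u₀ : ℝ), u₀ ∈ Icc 0 (cd.h j s') → SolvesOn cd φ j w (cd.h j s') →
        (∀ u ∈ Icc 0 (cd.h j s'), InBox cd (bx.lo j s') (bx.hi j s') (stAt φ j w u)) →
        ∀ z : Fin 4 → ℤ → ℝ, cd.InBall j (z - stAt φ j w u₀) (cd.κ j) →
          SolvesOn cd φ j z (cd.h j s' - u₀) ∧
          ∀ u ∈ Icc 0 (cd.h j s' - u₀), InBox cd (bx.loK j s') (bx.hiK j s') (stAt φ j z u - stAt φ j w (u₀ + u))) ∧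
      -- (F4′) segment derivatives on the κ-tube
      (∀ (w : Fin 4 → ℤ → ℝ) (u₀ : ℝ), u₀ ∈ Icc 0 (cd.h j s') → SolvesOn cd φ j w (cd.h j s') →
        (∀ u ∈ Icc 0 (cd.h j s'), InBox cd (bx.lo j s') (bx.hi j s') (stAt φ j w u)) →
        ∀ (z z' : Fin 4 → ℤ → ℝ) (dd : ℝ), cd.InBall j (z - stAt φ j w u₀) (cd.κ j) →
          cd.InBall j (z' - stAt φ j w u₀) (cd.κ j) → cd.InBall j (z - z') dd →
          ∀ i k, -cd.Kb ≤ k → k ≤ cd.Ka → ∀ t' ∈ Icc 0 (cd.h j s' - u₀), ∃ ψ : ℝ → ℝ, ∀ σ ∈ Icc (0:ℝ) 1,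
            HasDerivWithinAt (fun σ' : ℝ => φ j (z' + σ' • (z - z')) i k t') (ψ σ) (Icc 0 1) σ ∧
            |ψ σ| ≤ cd.L1 j s' * dd * cd.ω j k) ∧
      -- (F5′) Taylor model of every hull trajectory against its own jets
      (∀ z, InBox cd (bx.hlo 2 j s') (bx.hhi 2 j s') z → ∀ u ∈ Icc 0 (cd.h j s'), ∀ i k, -cd.Kb ≤ k → k ≤ cd.Ka →
        |stAt φ j z u i k - ∑ n ∈ Finset.range (cd.pdeg + 1), taylorJet cd.Qb z n i k * u ^ n|
          ≤ bx.J j s' i k * u ^ (cd.pdeg + 1)) ∧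
      -- (F7′) Fréchet derivative of the sub-step flow within the hull box (window coordinates), columns and their
      -- variational Taylor model
      (∀ zv ∈ Icc (toVec cd (bx.hlo 2 j s')) (toVec cd (bx.hhi 2 j s')), ∀ u ∈ Icc 0 (cd.h j s'),
        ∃ L : (Fin (nW cd) → ℝ) →L[ℝ] (Fin (nW cd) → ℝ),
          HasFDerivWithinAt (fun yv => flowSel (Qw cd) yv u) L
            (Icc (toVec cd (bx.hlo 2 j s')) (toVec cd (bx.hhi 2 j s'))) zv ∧
          (∀ c, L (Pi.single c 1) ∈ Icc ((wW cd j c)⁻¹ • toVec cd (bx.loV j s')) ((wW cd j c)⁻¹ • toVec cd (bx.hiV j s'))) ∧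
          ∀ c c', |L (Pi.single c 1) c'
              - ∑ n ∈ Finset.range (bx.pdegV + 1), varJet (Qw cd) zv (Pi.single c 1) n c' * u ^ n|
            ≤ toVec cd (bx.JU j s') c' * (wW cd j c)⁻¹ * u ^ (bx.pdegV + 1)) ∧
      -- (F8′) mean-value form of the one-step transport: a real matrix inside `[Mlo, Mhi]`
      (∀ z z', InBox cd (bx.hlo 2 j s') (bx.hhi 2 j s') z → InBox cd (bx.hlo 2 j s') (bx.hhi 2 j s') z' →
        ∃ A : Fin 4 → ℤ → Fin 4 → ℤ → ℝ,
          (∀ i' k', -cd.Kb ≤ k' → k' ≤ cd.Ka → ∀ i k, -cd.Kb ≤ k → k ≤ cd.Ka →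
            bx.Mlo j s' i' k' i k ≤ A i' k' i k ∧ A i' k' i k ≤ bx.Mhi j s' i' k' i k) ∧
          ∀ i' k', -cd.Kb ≤ k' → k' ≤ cd.Ka →
            (stAt φ j z (cd.h j s') - stAt φ j z' (cd.h j s')) i' k' =
              ∑ c : Fin (nW cd), A i' k' (modeOf cd c) (shellOf cd c) * toVec cd (z - z') c))

end Summit.NavierStokesRegularity.NavierStokesRegularity.Theorems.TaylorModelV

end
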